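import Summits.Ventures.QEC.Census.CertBits
import Literature.InformationTheory.QuantumCodes.BivariateBicycleCodes
import HarnessLib

/-!
# Bivariate-bicycle check rows computed in the kernel, with ONE identity theorem for all instances

Every kernel certificate about a typed bivariate-bicycle code `C : BB.Code ℓ m` (`QC(A, B)` on `ℤ_ℓ × ℤ_m`, Bravyi et al.
2024, `Literature/InformationTheory/QuantumCodes/BivariateBicycleCodes.lean`) needs its check matrices as row WORDS
(`rowMatrix n rows`, bit `j` = flat qubit `j`) together with the identities `rowMatrix n rowsX = C.HXFlat`,
`rowMatrix n rowsZ = C.HZFlat`. So far each instance shipped the words as decimal numerals and proved the identities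
ENTRYWISE by `decide +kernel` (`Census/BB/BB72Rank.lean` … `BB144Rank.lean`, `BB288Data.lean`, `BB360Data.lean`): `2·(ℓm)·(2ℓm)`
entries, ≈ 110 s of kernel time at `n = 288`, ≈ 260 s at `n = 360`, out of one file's budget at `n = 756`.

This file computes the words IN THE KERNEL from the monomial lists of `A` and `B` and proves the identities ONCE:

* `polyL L` — the polynomial `Σ_{(a,b) ∈ L} xᵃyᵇ` of a monomial list `L : List (ℤ_ℓ × ℤ_m)`;
* `rowX LA LB i` / `rowZ LA LB i` — the word of check `i ∈ ℤ_ℓ × ℤ_m` of `H^X = [A|B]` / `H^Z = [Bᵀ|Aᵀ]`: bit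
  `qubitIndex (L, i + g)` for `g ∈ LA` and `qubitIndex (R, i + g)` for `g ∈ LB` (resp. `(L, i − g)`, `g ∈ LB` and
  `(R, i − g)`, `g ∈ LA`), XOR-accumulated (so repeated monomials cancel, as in `𝔽₂`);
* `rowsX LA LB` / `rowsZ LA LB` — the `ℓm` words in the row order `checkIndex` (`List.ofFn`);
* **`rowMatrix_rowsX` / `rowMatrix_rowsZ`**: for every `C` with `C.A = polyL LA`, `C.B = polyL LB`,
  `rowMatrix (ℓm+ℓm) (rowsX LA LB) = C.HXFlat` (up to the `Fin.cast` along `length_rowsX`, definitionally the identity on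
  every concrete instance) — proved from `toMatrix_apply`, `HX_eq`/`HZ_eq` and the word lemmas of `Census/CertBits.lean`;
* instances: `rowsX_bb72 : rowMatrix 72 (rowsX la72 lb72) = BB.bb72.HXFlat` etc. for the Table-3 codes typed so far are
  ONE-LINERS (examples below for `bb72`; the `n = 360` words agree with the numerals of `Census/BB/BB360Words.lean` by
  `decide`, a regression check of both conventions).

Consequences: no numeral data files and no entrywise identity decides for BB instances any more; and the words a downstream
`decide +kernel` sees are kernel-built (the fast operand class measured by qec-search-7, 2026-08-27). All proved; axioms
standard; no `native_decide`. HONEST FRAMING: plumbing only — nothing here certifies a parameter of any code.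
-/

namespace Summit.Ventures.QEC.Census

open Matrix Literature.InformationTheory.QuantumCodes

namespace BBRows

variable {ℓ m : ℕ}

/-- The polynomial `Σ_{(a,b) ∈ L} xᵃ yᵇ` of a list of monomials `(a, b) ∈ ℤ_ℓ × ℤ_m`. (definition) -/
def polyL (L : List (BB.Mono ℓ m)) : BB.Poly ℓ m :=
  (L.map fun g => BB.monomial g.1 g.2).sum

/-- The flat index (`BB.Code.qubitIndex`) of a qubit, as a natural number. (definition) -/
def qIdx (s : BB.Mono ℓ m ⊕ BB.Mono ℓ m) : ℕ :=
  ((BB.Code.qubitIndex s : Fin (ℓ * m + ℓ * m)) : ℕ)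

/-- The word of the `H^X = [A|B]`-check `i`: bits `(L, i + g)`, `g ∈ LA`, and `(R, i + g)`, `g ∈ LB`. (definition) -/
def rowX (LA LB : List (BB.Mono ℓ m)) (i : BB.Mono ℓ m) : ℕ :=
  xorList (LA.map fun g => 2 ^ qIdx (Sum.inl (i + g))) ^^^
    xorList (LB.map fun g => 2 ^ qIdx (Sum.inr (i + g)))

/-- The word of the `H^Z = [Bᵀ|Aᵀ]`-check `i`: bits `(L, i − g)`, `g ∈ LB`, and `(R, i − g)`, `g ∈ LA`. (definition) -/
def rowZ (LA LB : List (BB.Mono ℓ m)) (i : BB.Mono ℓ m) : ℕ :=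
  xorList (LB.map fun g => 2 ^ qIdx (Sum.inl (i - g))) ^^^
    xorList (LA.map fun g => 2 ^ qIdx (Sum.inr (i - g)))

/-- All `H^X` check words, in the row order `checkIndex` (`row (a,b) = a·m + b`). (definition) -/
def rowsX (LA LB : List (BB.Mono ℓ m)) : List ℕ :=
  List.ofFn fun r : Fin (ℓ * m) => rowX LA LB (BB.Code.checkIndex.symm r)

/-- All `H^Z` check words, in the row order `checkIndex`. (definition) -/
def rowsZ (LA LB : List (BB.Mono ℓ m)) : List ℕ :=
  List.ofFn fun r : Fin (ℓ * m) => rowZ LA LB (BB.Code.checkIndex.symm r)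

/-- `rowsX` has `ℓm` entries. -/
theorem length_rowsX (LA LB : List (BB.Mono ℓ m)) : (rowsX LA LB).length = ℓ * m := by
  simp [rowsX]

/-- `rowsZ` has `ℓm` entries. -/
theorem length_rowsZ (LA LB : List (BB.Mono ℓ m)) : (rowsZ LA LB).length = ℓ * m := by
  simp [rowsZ]

/-! ## Semantics of the words -/

section Semantics

variable {n : ℕ}

/-- Evaluating a sum of functions at a point. -/
theorem list_sum_apply {α β : Type*} (L : List α) (F : α → β → ZMod 2) (x : β) :
    (L.map F).sum x = (L.map fun a => F a x).sum := by
  induction L with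
  | nil => rfl
  | cons a L ih => simp [ih]

/-- The word `2^p` is the basis vector at `p`. -/
theorem ofBits_two_pow_fin (p : Fin n) : ofBits n (2 ^ (p : ℕ)) = Pi.single p 1 := by
  rw [ofBits_two_pow n p p.2]

/-- A XOR of powers of two, read as a vector: the `𝔽₂`-sum of the indicator functions. -/
theorem ofBits_xorList_pow {α : Type*} (L : List α) (f : α → Fin n) (q : Fin n) :
    ofBits n (xorList (L.map fun a => 2 ^ ((f a : Fin n) : ℕ))) q =
      (L.map fun a => if q = f a then (1 : ZMod 2) else 0).sum := by
  rw [ofBits_xorList, List.map_map, list_sum_apply]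
  congr 1
  refine List.map_congr_left fun a _ => ?_
  simp only [Function.comp_apply, ofBits_two_pow_fin, Pi.single_apply]

/-- The value of `polyL L` at `g₀`: the number of occurrences of `g₀` in `L`, mod 2 (as a sum of indicators). -/
theorem polyL_apply (L : List (BB.Mono ℓ m)) (g₀ : BB.Mono ℓ m) :
    polyL L g₀ = (L.map fun g => if g₀ = g then (1 : ZMod 2) else 0).sum := by
  rw [polyL, list_sum_apply]
  congr 1
  refine List.map_congr_left fun g _ => ?_
  simp only [BB.monomial, Pi.single_apply, Prod.mk.eta]

variable [NeZero ℓ] [NeZero m]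

/-- **Semantics of `rowX`**: bit `q` of the `X`-check word of check `i` is the `(i, q)` entry of `H^X = [A|B]` read
through `qubitIndex`. -/
theorem ofBits_rowX (C : BB.Code ℓ m) {LA LB : List (BB.Mono ℓ m)} (hA : C.A = polyL LA) (hB : C.B = polyL LB)
    (i : BB.Mono ℓ m) (s : BB.Mono ℓ m ⊕ BB.Mono ℓ m) :
    ofBits (ℓ * m + ℓ * m) (rowX LA LB i) (BB.Code.qubitIndex s) = C.HX i s := by
  rw [rowX, ofBits_xor, Pi.add_apply]
  rw [show (fun g => 2 ^ qIdx (Sum.inl (i + g))) = fun g : BB.Mono ℓ m =>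
      2 ^ ((BB.Code.qubitIndex (Sum.inl (i + g)) : Fin (ℓ * m + ℓ * m)) : ℕ) from rfl,
    show (fun g => 2 ^ qIdx (Sum.inr (i + g))) = fun g : BB.Mono ℓ m =>
      2 ^ ((BB.Code.qubitIndex (Sum.inr (i + g)) : Fin (ℓ * m + ℓ * m)) : ℕ) from rfl,
    ofBits_xorList_pow, ofBits_xorList_pow]
  simp only [EmbeddingLike.apply_eq_iff_eq]
  rw [BB.Code.HX_eq]
  cases s with
  | inl c =>
    rw [fromCols_apply_inl, BB.toMatrix_apply, hA, polyL_apply]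
    have h2 : (LB.map fun g => if (Sum.inl c : BB.Mono ℓ m ⊕ BB.Mono ℓ m) = Sum.inr (i + g) then (1 : ZMod 2) else 0).sum
        = 0 := by
      rw [List.sum_eq_zero]
      intro x hx
      rw [List.mem_map] at hx
      obtain ⟨g, -, rfl⟩ := hx
      simp
    rw [h2, add_zero]
    congr 1
    refine List.map_congr_left fun g _ => ?_
    simp only [Sum.inl.injEq, eq_sub_iff_add_eq', eq_comm]
  | inr c =>
    rw [fromCols_apply_inr, BB.toMatrix_apply, hB, polyL_apply]
    have h1 : (LA.map fun g => if (Sum.inr c : BB.Mono ℓ m ⊕ BB.Mono ℓ m) = Sum.inl (i + g) then (1 : ZMod 2) else 0).sum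
        = 0 := by
      rw [List.sum_eq_zero]
      intro x hx
      rw [List.mem_map] at hx
      obtain ⟨g, -, rfl⟩ := hx
      simp
    rw [h1, zero_add]
    congr 1
    refine List.map_congr_left fun g _ => ?_
    simp only [Sum.inr.injEq, eq_sub_iff_add_eq', eq_comm]

/-- **Semantics of `rowZ`**: bit `q` of the `Z`-check word of check `i` is the `(i, q)` entry of `H^Z = [Bᵀ|Aᵀ]`. -/
theorem ofBits_rowZ (C : BB.Code ℓ m) {LA LB : List (BB.Mono ℓ m)} (hA : C.A = polyL LA) (hB : C.B = polyL LB)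
    (i : BB.Mono ℓ m) (s : BB.Mono ℓ m ⊕ BB.Mono ℓ m) :
    ofBits (ℓ * m + ℓ * m) (rowZ LA LB i) (BB.Code.qubitIndex s) = C.HZ i s := by
  rw [rowZ, ofBits_xor, Pi.add_apply]
  rw [show (fun g => 2 ^ qIdx (Sum.inl (i - g))) = fun g : BB.Mono ℓ m =>
      2 ^ ((BB.Code.qubitIndex (Sum.inl (i - g)) : Fin (ℓ * m + ℓ * m)) : ℕ) from rfl,
    show (fun g => 2 ^ qIdx (Sum.inr (i - g))) = fun g : BB.Mono ℓ m =>
      2 ^ ((BB.Code.qubitIndex (Sum.inr (i - g)) : Fin (ℓ * m + ℓ * m)) : ℕ) from rfl,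
    ofBits_xorList_pow, ofBits_xorList_pow]
  simp only [EmbeddingLike.apply_eq_iff_eq]
  rw [BB.Code.HZ_eq]
  cases s with
  | inl c =>
    rw [fromCols_apply_inl, transpose_apply, BB.toMatrix_apply, hB, polyL_apply]
    have h2 : (LA.map fun g => if (Sum.inl c : BB.Mono ℓ m ⊕ BB.Mono ℓ m) = Sum.inr (i - g) then (1 : ZMod 2) else 0).sum
        = 0 := by
      rw [List.sum_eq_zero]
      intro x hx
      rw [List.mem_map] at hx
      obtain ⟨g, -, rfl⟩ := hx
      simp
    rw [h2, add_zero]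
    congr 1
    refine List.map_congr_left fun g _ => ?_
    simp only [Sum.inl.injEq, eq_sub_iff_add_eq, eq_comm, add_comm]
  | inr c =>
    rw [fromCols_apply_inr, transpose_apply, BB.toMatrix_apply, hA, polyL_apply]
    have h1 : (LB.map fun g => if (Sum.inr c : BB.Mono ℓ m ⊕ BB.Mono ℓ m) = Sum.inl (i - g) then (1 : ZMod 2) else 0).sum
        = 0 := by
      rw [List.sum_eq_zero]
      intro x hx
      rw [List.mem_map] at hx
      obtain ⟨g, -, rfl⟩ := hx
      simp
    rw [h1, zero_add]
    congr 1
    refine List.map_congr_left fun g _ => ?_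
    simp only [Sum.inr.injEq, eq_sub_iff_add_eq, eq_comm, add_comm]

/-- **The identity for `H^X`**: the kernel-computed words ARE the typed flat check matrix `C.HXFlat` (along the cast
`Fin (rowsX LA LB).length = Fin (ℓm)`, which is the identity map on every concrete instance). -/
theorem rowMatrix_rowsX (C : BB.Code ℓ m) {LA LB : List (BB.Mono ℓ m)} (hA : C.A = polyL LA) (hB : C.B = polyL LB) :
    rowMatrix (ℓ * m + ℓ * m) (rowsX LA LB) =
      C.HXFlat.submatrix (fun r => Fin.cast (length_rowsX LA LB) r) id := by
  ext r q
  obtain ⟨s, rfl⟩ := BB.Code.qubitIndex.surjective q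
  have hget : (rowsX LA LB)[(r : ℕ)]'r.2 =
      rowX LA LB (BB.Code.checkIndex.symm (Fin.cast (length_rowsX LA LB) r)) := by
    simp [rowsX, Fin.cast]
  change ofBits (ℓ * m + ℓ * m) ((rowsX LA LB)[(r : ℕ)]'r.2) (BB.Code.qubitIndex s) = _
  rw [hget, ofBits_rowX C hA hB]
  simp [BB.Code.HXFlat]

/-- **The identity for `H^Z`**. -/
theorem rowMatrix_rowsZ (C : BB.Code ℓ m) {LA LB : List (BB.Mono ℓ m)} (hA : C.A = polyL LA) (hB : C.B = polyL LB) :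
    rowMatrix (ℓ * m + ℓ * m) (rowsZ LA LB) =
      C.HZFlat.submatrix (fun r => Fin.cast (length_rowsZ LA LB) r) id := by
  ext r q
  obtain ⟨s, rfl⟩ := BB.Code.qubitIndex.surjective q
  have hget : (rowsZ LA LB)[(r : ℕ)]'r.2 =
      rowZ LA LB (BB.Code.checkIndex.symm (Fin.cast (length_rowsZ LA LB) r)) := by
    simp [rowsZ, Fin.cast]
  change ofBits (ℓ * m + ℓ * m) ((rowsZ LA LB)[(r : ℕ)]'r.2) (BB.Code.qubitIndex s) = _
  rw [hget, ofBits_rowZ C hA hB]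
  simp [BB.Code.HZFlat]

end Semantics

/-! ## Instances: the monomial lists of the typed Table-3 codes and their one-line identities -/

/-- Monomials of `A = x³ + y + y²` on `ℤ₆ × ℤ₆` (`BB.bb72.A`). -/
def la72 : List (BB.Mono 6 6) := [(Fin.ofNat 6 3, 0), (0, Fin.ofNat 6 1), (0, Fin.ofNat 6 2)]
/-- Monomials of `B = y³ + x + x²` on `ℤ₆ × ℤ₆` (`BB.bb72.B`). -/
def lb72 : List (BB.Mono 6 6) := [(0, Fin.ofNat 6 3), (Fin.ofNat 6 1, 0), (Fin.ofNat 6 2, 0)]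

/-- `BB.bb72.A = polyL la72` (unfolding `xPow`/`yPow`). -/
theorem bb72_A : BB.bb72.A = polyL la72 := by
  simp only [BB.bb72, polyL, la72, List.map, List.sum_cons, List.sum_nil, add_zero, BB.xPow, BB.yPow, add_assoc]

/-- `BB.bb72.B = polyL lb72`. -/
theorem bb72_B : BB.bb72.B = polyL lb72 := by
  simp only [BB.bb72, polyL, lb72, List.map, List.sum_cons, List.sum_nil, add_zero, BB.xPow, BB.yPow, add_assoc]

/-- **`rowMatrix 72 (rowsX la72 lb72) = BB.bb72.HXFlat`** — the `[[72,12,6]]` identity as a one-liner (no numerals,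
no entrywise decide). -/
theorem rowsX_bb72 : rowMatrix 72 (rowsX la72 lb72) = BB.bb72.HXFlat :=
  rowMatrix_rowsX BB.bb72 bb72_A bb72_B

/-- **`rowMatrix 72 (rowsZ la72 lb72) = BB.bb72.HZFlat`**. -/
theorem rowsZ_bb72 : rowMatrix 72 (rowsZ la72 lb72) = BB.bb72.HZFlat :=
  rowMatrix_rowsZ BB.bb72 bb72_A bb72_B


/-! ### The other typed Table-3 codes (`bb90`, `bb108`, `bb144`, `bb288`; `bb360` in `BivariateBicycleCode360.lean` is
handled identically by any file importing it — lists `[(Fin.ofNat 30 9, 0), (0, Fin.ofNat 6 1), (0, Fin.ofNat 6 2)]` /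
`[(0, Fin.ofNat 6 3), (Fin.ofNat 30 25, 0), (Fin.ofNat 30 26, 0)]`) -/

/-- Monomials of `BB.bb90.A = x⁹ + y + y²` on `ℤ₁₅ × ℤ₃`. -/
def la90 : List (BB.Mono 15 3) := [(Fin.ofNat 15 9, 0), (0, Fin.ofNat 3 1), (0, Fin.ofNat 3 2)]
/-- Monomials of `BB.bb90.B = 1 + x² + x⁷` on `ℤ₁₅ × ℤ₃`. -/
def lb90 : List (BB.Mono 15 3) := [(Fin.ofNat 15 0, 0), (Fin.ofNat 15 2, 0), (Fin.ofNat 15 7, 0)]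
/-- `BB.bb90.A = polyL la90`. -/
theorem bb90_A : BB.bb90.A = polyL la90 := by
  simp only [BB.bb90, polyL, la90, List.map, List.sum_cons, List.sum_nil, add_zero, BB.xPow, BB.yPow, add_assoc]
/-- `BB.bb90.B = polyL lb90`. -/
theorem bb90_B : BB.bb90.B = polyL lb90 := by
  simp only [BB.bb90, polyL, lb90, List.map, List.sum_cons, List.sum_nil, add_zero, BB.xPow, BB.yPow, add_assoc]
/-- `rowMatrix 90 (rowsX la90 lb90) = BB.bb90.HXFlat`. -/
theorem rowsX_bb90 : rowMatrix 90 (rowsX la90 lb90) = BB.bb90.HXFlat := rowMatrix_rowsX BB.bb90 bb90_A bb90_B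
/-- `rowMatrix 90 (rowsZ la90 lb90) = BB.bb90.HZFlat`. -/
theorem rowsZ_bb90 : rowMatrix 90 (rowsZ la90 lb90) = BB.bb90.HZFlat := rowMatrix_rowsZ BB.bb90 bb90_A bb90_B

/-- Monomials of `BB.bb108.A = x³ + y + y²` on `ℤ₉ × ℤ₆`. -/
def la108 : List (BB.Mono 9 6) := [(Fin.ofNat 9 3, 0), (0, Fin.ofNat 6 1), (0, Fin.ofNat 6 2)]
/-- Monomials of `BB.bb108.B = y³ + x + x²` on `ℤ₉ × ℤ₆`. -/
def lb108 : List (BB.Mono 9 6) := [(0, Fin.ofNat 6 3), (Fin.ofNat 9 1, 0), (Fin.ofNat 9 2, 0)]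
/-- `BB.bb108.A = polyL la108`. -/
theorem bb108_A : BB.bb108.A = polyL la108 := by
  simp only [BB.bb108, polyL, la108, List.map, List.sum_cons, List.sum_nil, add_zero, BB.xPow, BB.yPow, add_assoc]
/-- `BB.bb108.B = polyL lb108`. -/
theorem bb108_B : BB.bb108.B = polyL lb108 := by
  simp only [BB.bb108, polyL, lb108, List.map, List.sum_cons, List.sum_nil, add_zero, BB.xPow, BB.yPow, add_assoc]
/-- `rowMatrix 108 (rowsX la108 lb108) = BB.bb108.HXFlat`. -/
theorem rowsX_bb108 : rowMatrix 108 (rowsX la108 lb108) = BB.bb108.HXFlat := rowMatrix_rowsX BB.bb108 bb108_A bb108_B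
/-- `rowMatrix 108 (rowsZ la108 lb108) = BB.bb108.HZFlat`. -/
theorem rowsZ_bb108 : rowMatrix 108 (rowsZ la108 lb108) = BB.bb108.HZFlat := rowMatrix_rowsZ BB.bb108 bb108_A bb108_B

/-- Monomials of `BB.bb144.A = x³ + y + y²` on `ℤ₁₂ × ℤ₆`. -/
def la144 : List (BB.Mono 12 6) := [(Fin.ofNat 12 3, 0), (0, Fin.ofNat 6 1), (0, Fin.ofNat 6 2)]
/-- Monomials of `BB.bb144.B = y³ + x + x²` on `ℤ₁₂ × ℤ₆`. -/
def lb144 : List (BB.Mono 12 6) := [(0, Fin.ofNat 6 3), (Fin.ofNat 12 1, 0), (Fin.ofNat 12 2, 0)]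
/-- `BB.bb144.A = polyL la144`. -/
theorem bb144_A : BB.bb144.A = polyL la144 := by
  simp only [BB.bb144, polyL, la144, List.map, List.sum_cons, List.sum_nil, add_zero, BB.xPow, BB.yPow, add_assoc]
/-- `BB.bb144.B = polyL lb144`. -/
theorem bb144_B : BB.bb144.B = polyL lb144 := by
  simp only [BB.bb144, polyL, lb144, List.map, List.sum_cons, List.sum_nil, add_zero, BB.xPow, BB.yPow, add_assoc]
/-- `rowMatrix 144 (rowsX la144 lb144) = BB.bb144.HXFlat`. -/
theorem rowsX_bb144 : rowMatrix 144 (rowsX la144 lb144) = BB.bb144.HXFlat := rowMatrix_rowsX BB.bb144 bb144_A bb144_B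
/-- `rowMatrix 144 (rowsZ la144 lb144) = BB.bb144.HZFlat`. -/
theorem rowsZ_bb144 : rowMatrix 144 (rowsZ la144 lb144) = BB.bb144.HZFlat := rowMatrix_rowsZ BB.bb144 bb144_A bb144_B

/-- Monomials of `BB.bb288.A = x³ + y² + y⁷` on `ℤ₁₂ × ℤ₁₂`. -/
def la288 : List (BB.Mono 12 12) := [(Fin.ofNat 12 3, 0), (0, Fin.ofNat 12 2), (0, Fin.ofNat 12 7)]
/-- Monomials of `BB.bb288.B = y³ + x + x²` on `ℤ₁₂ × ℤ₁₂`. -/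
def lb288 : List (BB.Mono 12 12) := [(0, Fin.ofNat 12 3), (Fin.ofNat 12 1, 0), (Fin.ofNat 12 2, 0)]
/-- `BB.bb288.A = polyL la288`. -/
theorem bb288_A : BB.bb288.A = polyL la288 := by
  simp only [BB.bb288, polyL, la288, List.map, List.sum_cons, List.sum_nil, add_zero, BB.xPow, BB.yPow, add_assoc]
/-- `BB.bb288.B = polyL lb288`. -/
theorem bb288_B : BB.bb288.B = polyL lb288 := by
  simp only [BB.bb288, polyL, lb288, List.map, List.sum_cons, List.sum_nil, add_zero, BB.xPow, BB.yPow, add_assoc]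
/-- `rowMatrix 288 (rowsX la288 lb288) = BB.bb288.HXFlat`. -/
theorem rowsX_bb288 : rowMatrix 288 (rowsX la288 lb288) = BB.bb288.HXFlat := rowMatrix_rowsX BB.bb288 bb288_A bb288_B
/-- `rowMatrix 288 (rowsZ la288 lb288) = BB.bb288.HZFlat`. -/
theorem rowsZ_bb288 : rowMatrix 288 (rowsZ la288 lb288) = BB.bb288.HZFlat := rowMatrix_rowsZ BB.bb288 bb288_A bb288_B

end BBRows

end Summit.Ventures.QEC.Census
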